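import Summits.Ventures.Crystal3D.Theorems.StickyWulffConstantGenericWallFloorAtOfFar
import HarnessLib

/-!
# `GenericWallFloor` BY NAME from its three named residual inputs: `ExactOnly`(C12-55), `StarPairFar`, and the
# RAY-ALIGNED CORE (crux `GenericWallFloor`, stmt-Ventures-19480, line `WallLedgerG`)

HONEST FRAMING. Venture `Summits/Ventures/Crystal3D` (cell `crystal3d-full`), helper `--supports` the crux
`GenericWallFloor` of `route-Ventures-StickyWulffConstant`, REGISTERED line `WallLedgerG`, open stub
`stub_twoSlabAdhesion` (general fillings).  BOOKKEEPING CAPSTONE, rung credit only; F-C1 not moved; NOT the crux.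

After 19480-p2 g3/g4 (`…StackLedgerLocal*`, `…AtOfLedger`) and 19480-p1 g5 (`…StarPairFar`, `…AtOfFar`) the crux's
conclusion `GenericWallFloorAt A₁ t₁ A₂ t₂` (the matrix of the route decl, verbatim, `c₀ = 1`) holds, modulo the two named
computations `ExactOnly`(C12-55) [E1] and `StarPairFar` [certified ×2], for every pair admitting a steep up-slot `u₁` of
grain 1 and a steep down-slot `u₂` of grain 2 whose countable forced-ray frame sets `chainFrames e₃ A₁ u₁`,
`chainFrames (−e₃) A₂ u₂` are pairwise NON-co-axial (`genericWallFloorAt_chain_of_far`; non-chain pairs are the case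
where this holds for trivial reasons, `genericWallFloorAt_nonChain_of_far`).  This file names the EXACT complement and
closes the books:

* `RayAlignedAt A₁ A₂` — for EVERY steep slot pair some grain-1 chain frame is co-axial with some grain-2 chain frame
  (ROUTE.md §84 R41t: the cells `l + c ≥ k − 1` of a `Σ3ᵏ` chain pair; for `Σ9` simply `u₁ ∉ π₁ ∨ u₂ ∉ π₂` for all
  steep choices);
* `GenericWallFloorCore` — the crux's matrix, verbatim, on the ray-aligned non-co-axial pairs: THE RESIDUAL of lane G
  (planner §84(xiii): an inclined-twin law at constant `≥ 1.06` lives here);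
* **`genericWallFloor_of_core`** — `ExactOnly`(C12-55) → `StarPairFar` → `GenericWallFloorCore` →
  `Summit.Ventures.Crystal3D.Theses.StickyWulffConstant.GenericWallFloor` (the route decl BY NAME), by excluded middle
  on `RayAlignedAt` and `genericWallFloorAt_chain_of_far`; `genericWallFloor_of_core_star` is the same with the
  stars-only double-end input `StarPairCoaxial` in place of its certified form.

So the crux is, in the kernel, EQUIVALENT-IN-DEBT to three named statements: two certified computations on the
planner's admissible list (§84(xii)) and one typed residual.  WHAT THIS IS NOT: a proof of any of the three; the
residual `GenericWallFloorCore` is open (F-hard); F-C1 not moved.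
-/

noncomputable section

namespace Summit.Ventures.Crystal3D.Theorems

open Summit.Ventures.Crystal3D Finset
open Literature.MathematicalPhysics.StatisticalMechanics (fccStacking barlowStacking IsHaggSeq)
open scoped InnerProductSpace

/-- **RAY-ALIGNED pair** (the exact complement of the ray-separation hypothesis of
`genericWallFloorAt_chain_of_far`): for every steep up-slot `u₁` of grain 1 (`⟪A₁u₁, e₃⟫ ≥ √2/2`) and every steep
down-slot `u₂` of grain 2 (`⟪A₂u₂, e₃⟫ ≤ −√2/2`) some forced-ray frame of grain 1 (`chainFrames e₃ A₁ u₁`) is CO-AXIAL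
with some forced-ray frame of grain 2 (`chainFrames (−e₃) A₂ u₂`) — a common linear Barlow frame `L` up to
translations.  (R41t: the cells `l + c ≥ k − 1` of a chain pair at twin-tree distance `k ≥ 2`.) -/
def RayAlignedAt (A₁ A₂ : EuclideanSpace ℝ (Fin 3) ≃ₗᵢ[ℝ] EuclideanSpace ℝ (Fin 3)) : Prop :=
  ∀ u₁ ∈ fccSlots, Real.sqrt 2 / 2 ≤ ⟪A₁ u₁, EuclideanSpace.single (2 : Fin 3) (1 : ℝ)⟫_ℝ →
  ∀ u₂ ∈ fccSlots, ⟪A₂ u₂, EuclideanSpace.single (2 : Fin 3) (1 : ℝ)⟫_ℝ ≤ -(Real.sqrt 2 / 2) →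
    ∃ F₁ ∈ chainFrames (EuclideanSpace.single (2 : Fin 3) (1 : ℝ)) A₁ u₁,
    ∃ F₂ ∈ chainFrames (-EuclideanSpace.single (2 : Fin 3) (1 : ℝ)) A₂ u₂,
      ∃ (L : EuclideanSpace ℝ (Fin 3) ≃ₗᵢ[ℝ] EuclideanSpace ℝ (Fin 3))
        (s₁ s₂ : EuclideanSpace ℝ (Fin 3)) (σ σ' : ℤ → ℤ), IsHaggSeq σ ∧ IsHaggSeq σ' ∧
        F₁ '' fccStacking 1 (Real.sqrt (2 / 3)) ⊆ (fun p => L p + s₁) '' barlowStacking 1 (Real.sqrt (2 / 3)) σ ∧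
        F₂ '' fccStacking 1 (Real.sqrt (2 / 3)) ⊆ (fun p => L p + s₂) '' barlowStacking 1 (Real.sqrt (2 / 3)) σ'

/-- **The RESIDUAL of lane G** (`GenericWallFloorCore`): the matrix of the route decl `GenericWallFloor`, verbatim
(`GenericWallFloorAt`, `c₀ = 1`), for every NON-co-axial pair of moved fcc lattices that is RAY-ALIGNED.  By
`genericWallFloor_of_core` this, `ExactOnly`(C12-55) and `StarPairFar` give the crux by name.  (Planner §84(xiii): on
this core the crux is an inclined-twin law at constant `≥ 1.06`; cheapest known competitor `2.31`, R41t/R29.) -/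
def GenericWallFloorCore : Prop :=
  ∀ (A₁ : EuclideanSpace ℝ (Fin 3) ≃ₗᵢ[ℝ] EuclideanSpace ℝ (Fin 3)) (t₁ : EuclideanSpace ℝ (Fin 3))
    (A₂ : EuclideanSpace ℝ (Fin 3) ≃ₗᵢ[ℝ] EuclideanSpace ℝ (Fin 3)) (t₂ : EuclideanSpace ℝ (Fin 3)),
    ¬ (∃ (L : EuclideanSpace ℝ (Fin 3) ≃ₗᵢ[ℝ] EuclideanSpace ℝ (Fin 3)) (s₁ s₂ : EuclideanSpace ℝ (Fin 3))
        (σ σ' : ℤ → ℤ), IsHaggSeq σ ∧ IsHaggSeq σ' ∧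
        (fun p => A₁ p + t₁) '' fccStacking 1 (Real.sqrt (2 / 3)) ⊆
          (fun p => L p + s₁) '' barlowStacking 1 (Real.sqrt (2 / 3)) σ ∧
        (fun p => A₂ p + t₂) '' fccStacking 1 (Real.sqrt (2 / 3)) ⊆
          (fun p => L p + s₂) '' barlowStacking 1 (Real.sqrt (2 / 3)) σ') →
    RayAlignedAt A₁ A₂ → GenericWallFloorAt A₁ t₁ A₂ t₂

/-- Outside the ray-aligned core there IS a separated steep slot pair (the negation, unfolded). -/
theorem exists_separated_of_not_rayAlignedAt
    {A₁ A₂ : EuclideanSpace ℝ (Fin 3) ≃ₗᵢ[ℝ] EuclideanSpace ℝ (Fin 3)} (h : ¬ RayAlignedAt A₁ A₂) :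
    ∃ u₁ ∈ fccSlots, Real.sqrt 2 / 2 ≤ ⟪A₁ u₁, EuclideanSpace.single (2 : Fin 3) (1 : ℝ)⟫_ℝ ∧
    ∃ u₂ ∈ fccSlots, ⟪A₂ u₂, EuclideanSpace.single (2 : Fin 3) (1 : ℝ)⟫_ℝ ≤ -(Real.sqrt 2 / 2) ∧
      ∀ F₁ ∈ chainFrames (EuclideanSpace.single (2 : Fin 3) (1 : ℝ)) A₁ u₁,
      ∀ F₂ ∈ chainFrames (-EuclideanSpace.single (2 : Fin 3) (1 : ℝ)) A₂ u₂,
      ¬ ∃ (L : EuclideanSpace ℝ (Fin 3) ≃ₗᵢ[ℝ] EuclideanSpace ℝ (Fin 3))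
        (s₁ s₂ : EuclideanSpace ℝ (Fin 3)) (σ σ' : ℤ → ℤ), IsHaggSeq σ ∧ IsHaggSeq σ' ∧
        F₁ '' fccStacking 1 (Real.sqrt (2 / 3)) ⊆ (fun p => L p + s₁) '' barlowStacking 1 (Real.sqrt (2 / 3)) σ ∧
        F₂ '' fccStacking 1 (Real.sqrt (2 / 3)) ⊆ (fun p => L p + s₂) '' barlowStacking 1 (Real.sqrt (2 / 3)) σ' := by
  by_contra hcon
  apply h
  intro u₁ hu₁ hst₁ u₂ hu₂ hst₂
  by_contra hno
  apply hcon
  refine ⟨u₁, hu₁, hst₁, u₂, hu₂, hst₂, fun F₁ hF₁ F₂ hF₂ hco => hno ⟨F₁, hF₁, F₂, hF₂, hco⟩⟩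

/-- **The crux BY NAME from its three named residual inputs, stars-only form.**  `ExactOnly`(C12-55) [E1],
the stars-only double-end input `StarPairCoaxial`, and the residual `GenericWallFloorCore` give
`Summit.Ventures.Crystal3D.Theses.StickyWulffConstant.GenericWallFloor`. -/
theorem genericWallFloor_of_core_star
    {s₀ : EuclideanSpace ℝ (Fin 3)} (hs₀ : s₀ ∈ fccSlots)
    (hcert : ExactOnly 0 (fccSlots.filter fun w => 0 < ⟪w, s₀⟫_ℝ)) (hSP : StarPairCoaxial)
    (hcore : GenericWallFloorCore) :
    Summit.Ventures.Crystal3D.Theses.StickyWulffConstant.GenericWallFloor := by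
  rw [genericWallFloor_iff_at]
  intro A₁ t₁ A₂ t₂ hnc
  by_cases hra : RayAlignedAt A₁ A₂
  · exact hcore A₁ t₁ A₂ t₂ hnc hra
  · obtain ⟨u₁, hu₁, hst₁, u₂, hu₂, hst₂, hsep⟩ := exists_separated_of_not_rayAlignedAt hra
    exact genericWallFloorAt_chain_of_star hs₀ hcert hSP A₁ t₁ A₂ t₂ hu₁ hst₁ hu₂ hst₂ hsep

/-- **The crux BY NAME from its three named residual inputs.**  The E1 row `ExactOnly`(C12-55), the CERTIFIED
computation `StarPairFar` (lit g13 kit j298152–5; wulff-p2 g10 kit j298800) and the residual `GenericWallFloorCore`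
give `Summit.Ventures.Crystal3D.Theses.StickyWulffConstant.GenericWallFloor`. -/
theorem genericWallFloor_of_core
    {s₀ : EuclideanSpace ℝ (Fin 3)} (hs₀ : s₀ ∈ fccSlots)
    (hcert : ExactOnly 0 (fccSlots.filter fun w => 0 < ⟪w, s₀⟫_ℝ)) (hfar : StarPairFar)
    (hcore : GenericWallFloorCore) :
    Summit.Ventures.Crystal3D.Theses.StickyWulffConstant.GenericWallFloor :=
  genericWallFloor_of_core_star hs₀ hcert (starPairCoaxial_of_far hfar) hcore

/-- Conversely the crux contains its residual (so `GenericWallFloorCore` is not a strengthening). -/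
theorem genericWallFloorCore_of_genericWallFloor
    (h : Summit.Ventures.Crystal3D.Theses.StickyWulffConstant.GenericWallFloor) : GenericWallFloorCore :=
  fun A₁ t₁ A₂ t₂ hnc _ => (genericWallFloor_iff_at.1 h) A₁ t₁ A₂ t₂ hnc

end Summit.Ventures.Crystal3D.Theorems

end
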